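import Mathlib.Algebra.Polynomial.Taylor
import Mathlib.Algebra.Polynomial.Reverse
import Mathlib.Algebra.GroupWithZero.WithZero
import Literature.IUT.HodgeTheaters.GlobalFrobenioidsInfKappa
import Literature.IUT.HodgeTheaters.KappaCoricFunctionsProofs
import HarnessLib

/-!
# [IUTchI] Example 5.1 (v) p. 129: the restriction data at the strictly critical points —
# non-vacuity of `CriticalRestrictionData` at the model of Remark 3.1.7 (proof-only)

Mochizuki, *Inter-universal Teichmüller theory I*, §5, Example 5.1 (v), kurims manuscript (May 2020)
p. 129, first display, and §3 Remark 3.1.7 (i)(ii) pp. 66–67 ([IUTchI] Ex 5.1 (v) p.129, Rmk 3.1.7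
pp.66–67) [claim: Mochizuki2012, status: disputed].  PROOF-ONLY companion (no definitions) of
`GlobalFrobenioidsInfKappa.lean` (abc-iut-L5-t12), whose DATA record
`CriticalRestrictionData Γ H` — "restriction of Kummer classes [`H`] to the subgroups of
`π₁^rat(†𝒟^⊛)` that correspond to an open subgroup of the decomposition group of some strictly
critical point of `C_{F_mod}`" — had no inhabitant in the kernel (NV-L5 census row, L5-lead RULINGS
#27/#28).  Nothing of the disputed content is asserted; a witness is consistency evidence only.

WHAT IS WITNESSED.

* `nonempty_criticalRestrictionData_degenerate` [label: DEGENERATE]: the record carries no laws, so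
  it is inhabited over ANY `(Γ, H)` by the empty family of subgroups.  Recorded only to document
  that fact; it is not evidence for anything beyond "the type is inhabited".

* `CriticalLocus.exists_criticalRestrictionData_model` [label: MODEL]: the GENUINE restriction data
  at the model of Remark 3.1.7 — rational functions `f ∈ Ω(t)` on `|C_L| ≅ 𝔸¹` (cusp at `∞`,
  abc-iut-L5-t2's `CriticalLocus Ω` = the three strictly critical points).  For a strictly critical
  point `e` the decomposition group `D_e ⊆ π₁^rat` of the valuation `ord_e` receives the Kummer class
  of `f ∈ Ω(t)^×` through the completion `Ω((t - e))^× = (t-e)^ℤ · Ω^× · U¹` with `U¹` the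
  (divisible, Kummer-invisible) one-units; so the restricted class is the pair
  `(ord_e f, lc_e f) ∈ ℤ × Ω^×` (order and leading coefficient of `f` at `e`; in characteristic zero
  the one-units are divisible, hence invisible to Kummer classes), and it "is a torsion element
  [i.e., corresponds to a root of unity]" (p. 129) iff `ord_e f = 0` and `f(e)` is a root of unity.  The witness takes `H := Ω(t)^×` (the Kummer container of the model pairs, cf.
  `CoricPair.KummerRealization`), index set := the strictly critical points, the subgroup at `e` :=
  the stabiliser of `e` under the given action `Γ ↷ Ω` [the decomposition group of the point `e`
  for a Galois group acting on `L̄`-points; for `π₁^rat` acting through `π₁^rat ↠ Gal`, its full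
  preimage], target := `ℤ × Ω^×` (written `Multiplicative ℤ × Ωˣ`)
  and `res_e f := (ord_e f, lc_e f)`, constructed from Mathlib's `Polynomial.taylor`,
  `natTrailingDegree`/`trailingCoeff` and `RatFunc.liftMonoidWithZeroHom`; and PROVES the printed
  reading: `res_e f` has finite order iff `f(e)` is a root of unity (for `f` with a zero or pole at
  `e` the class has infinite order and `RatFunc.eval` returns `0`, so both sides fail).

* `CriticalLocus.torsionLocus_eq_of_res_iff`, `CriticalLocus.isOfFinOrder_res_some_iff_every`,
  `CriticalLocus.exists_criticalRestrictionData_rmk317ii` [MODEL]: for ANY restriction data with that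
  property, abc-iut-L5-t12's `CoricPair.torsionLocus κ R` is the set of elements whose Kummer image
  takes a root-of-unity value at some strictly critical point, and on `∞κ×`-coric functions "some
  [or, equivalently, every]" (p. 129 = Rmk 3.1.7 (ii), abc-iut-L5-t2's DISCHARGED
  `inftyKappaUnitCoricCriterion_holds`) holds, both readings being equivalent to `∞κ`-coricity —
  i.e. the clause `DeterminesInfκStructure.some_iff_every` and the identification of the torsion
  locus with `𝕄^⊛_∞κ` at the model.

No new definitions, no new named facts; no printed statement is strengthened; no side is taken on
[IUTchIII] Cor. 3.12.
-/

namespace Literature.IUT.HodgeTheaters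

open Polynomial
open scoped RatFunc

universe u

/-! ### The record is law-free: a DEGENERATE inhabitant over any `(Γ, H)` -/

/-- [DEGENERATE — documents only that the DATA record `CriticalRestrictionData` carries no laws:
the empty family of subgroups inhabits it over any group `Γ` and any abelian group `H`.  Not to be
cited as a model.] ([IUTchI] Ex 5.1 (v) p.129) [claim: Mochizuki2012, status: disputed] -/
theorem nonempty_criticalRestrictionData_degenerate (Γ : Type u) [Group Γ] (H : Type u)
    [CommGroup H] : Nonempty (CriticalRestrictionData Γ H) :=
  ⟨{ Idx := PEmpty
     subgroup := fun i => i.elim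
     target := fun _ => H
     res := fun i => i.elim }⟩

/-! ### The MODEL: restriction of Kummer classes of rational functions at the strictly critical points -/

namespace CriticalLocus

variable {Ω : Type u} [Field Ω]

/-- Auxiliary computation (Remark 3.1.7 model): for a nonzero polynomial `p` and a point `e`,
`p(e) ≠ 0` iff the order of `p` at `e` [the trailing degree of `p(t + e)`] vanishes, and then the
leading coefficient of `p` at `e` [the trailing coefficient of `p(t + e)`] is `p(e)`.
([IUTchI] Rmk 3.1.7 (i) p.66) [claim: Mochizuki2012, status: disputed] -/
private theorem natTrailingDegree_taylor_eq_zero_iff {p : Ω[X]} (hp : p ≠ 0) (e : Ω) :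
    (taylor e p).natTrailingDegree = 0 ↔ p.eval e ≠ 0 := by
  constructor
  · intro h0 hpe
    have hcoeff : (taylor e p).coeff 0 = 0 := by rw [taylor_coeff_zero, hpe]
    have hne : taylor e p ≠ 0 := by rwa [Ne, taylor_eq_zero]
    have h1 : 1 ≤ (taylor e p).natTrailingDegree :=
      le_natTrailingDegree hne fun m hm => by
        obtain rfl : m = 0 := by omega
        exact hcoeff
    omega
  · intro hpe
    apply natTrailingDegree_eq_zero_of_constantCoeff_ne_zero
    rwa [constantCoeff_apply, taylor_coeff_zero]

/-- Auxiliary computation: if `p(e) ≠ 0` then the trailing coefficient of `p(t + e)` is `p(e)`.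
([IUTchI] Rmk 3.1.7 (i) p.66) [claim: Mochizuki2012, status: disputed] -/
private theorem trailingCoeff_taylor_of_eval_ne_zero {p : Ω[X]} {e : Ω} (hpe : p.eval e ≠ 0) :
    (taylor e p).trailingCoeff = p.eval e := by
  rw [trailingCoeff_eq_coeff_zero (by rwa [taylor_coeff_zero]), taylor_coeff_zero]

/-- Auxiliary computation: the numerator and the denominator of a rational function do not both
vanish at a point (they are coprime). ([IUTchI] Rmk 3.1.7 (i) p.66) [claim: Mochizuki2012, status: disputed] -/
private theorem not_eval_num_denom_eq_zero (f : RatFunc Ω) (e : Ω) :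
    ¬ (f.num.eval e = 0 ∧ f.denom.eval e = 0) := by
  rintro ⟨hn, hd⟩
  have hu : IsUnit (X - C e) :=
    (RatFunc.isCoprime_num_denom f).isUnit_of_dvd' (dvd_iff_isRoot.mpr hn) (dvd_iff_isRoot.mpr hd)
  exact not_isUnit_X_sub_C e hu

/-- An element of `Multiplicative ℤ × Ωˣ` of the form `(m - n, a / b)` has finite order iff `m = n`
and `(a/b)^N = 1` for some `N > 0`. ([IUTchI] Ex 5.1 (v) p.129) [claim: Mochizuki2012, status: disputed] -/
private theorem isOfFinOrder_prod_iff (z : Multiplicative ℤ) (u : Ωˣ) :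
    IsOfFinOrder ((z, u) : Multiplicative ℤ × Ωˣ) ↔
      Multiplicative.toAdd z = 0 ∧ ∃ N : ℕ, 0 < N ∧ (u : Ω) ^ N = 1 := by
  rw [isOfFinOrder_iff_pow_eq_one]
  constructor
  · rintro ⟨N, hN, h⟩
    rw [Prod.ext_iff] at h
    obtain ⟨h1, h2⟩ := h
    simp only [Prod.pow_fst, Prod.pow_snd, Prod.fst_one, Prod.snd_one] at h1 h2
    refine ⟨?_, N, hN, ?_⟩
    · have h1' : N • Multiplicative.toAdd z = 0 := by
        rw [← toAdd_pow, h1, toAdd_one]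
      rw [nsmul_eq_mul, mul_eq_zero] at h1'
      rcases h1' with h | h
      · exact absurd h (by exact_mod_cast hN.ne')
      · exact h
    · rw [← Units.val_pow_eq_pow_val, h2, Units.val_one]
  · rintro ⟨hz, N, hN, hu⟩
    refine ⟨N, hN, Prod.ext ?_ ?_⟩
    · simp only [Prod.pow_fst, Prod.fst_one]
      have : z = 1 := by
        rw [← ofAdd_toAdd z, hz, ofAdd_zero]
      rw [this, one_pow]
    · simp only [Prod.pow_snd, Prod.snd_one]
      ext
      rw [Units.val_pow_eq_pow_val, hu, Units.val_one]

/-- **[MODEL] Non-vacuity of `CriticalRestrictionData` at the model of Remark 3.1.7.**  For the three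
strictly critical points `S` of `|C_L| ≅ 𝔸¹` (abc-iut-L5-t2's `CriticalLocus Ω`) and any group `Γ`
acting on the `Ω`-points [a Galois group; `π₁^rat(†𝒟^⊛)` through its quotient], there is restriction
data for the Kummer container `H := Ω(t)^×` of the model pairs, indexed by the strictly critical
points, whose subgroup at `e` is the stabiliser [decomposition group] of `e` and whose restriction map
at `e` — the class of `f` in the Kummer-visible quotient `ℤ × Ω^×` of `Ω((t-e))^×`, `f ↦ (ord_e f,
lc_e f)` — has FINITE ORDER exactly when "`f` restricts to a root of unity at `e`": `f(e)^N = 1` for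
some `N > 0` (Mathlib's `RatFunc.eval`, which is `0` at a zero or pole).  This is the printed reading
"is a torsion element [i.e., corresponds to a root of unity]" (p. 129).
([IUTchI] Ex 5.1 (v) p.129) [claim: Mochizuki2012, status: disputed] -/
theorem exists_criticalRestrictionData_model (S : CriticalLocus Ω) (Γ : Type u) [Group Γ]
    [MulAction Γ Ω] :
    ∃ (R : CriticalRestrictionData Γ (RatFunc Ω)ˣ) (pt : R.Idx ≃ ↥S.pts),
      (∀ i, R.subgroup i = MulAction.stabilizer Γ ((pt i : ↥S.pts) : Ω)) ∧
      ∀ (i : R.Idx) (f : (RatFunc Ω)ˣ), IsOfFinOrder (R.res i f) ↔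
        ∃ N : ℕ, 0 < N ∧ ((f : RatFunc Ω).eval (RingHom.id Ω) ((pt i : ↥S.pts) : Ω)) ^ N = 1 := by
  classical
  -- the order/leading-coefficient map of polynomials at `e`, as a monoid-with-zero hom
  let φ : Ω → (Ω[X] →*₀ WithZero (Multiplicative ℤ × Ωˣ)) := fun e =>
    { toFun := fun p => if hp : p = 0 then 0 else
        (((Multiplicative.ofAdd ((taylor e p).natTrailingDegree : ℤ),
          Units.mk0 (taylor e p).trailingCoeff
            (by rwa [Ne, trailingCoeff_eq_zero, taylor_eq_zero])) : Multiplicative ℤ × Ωˣ) :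
          WithZero (Multiplicative ℤ × Ωˣ))
      map_zero' := by simp only [dif_pos]
      map_one' := by
        rw [dif_neg one_ne_zero]
        have ht : taylor e (1 : Ω[X]) = 1 := by rw [taylor_one, C_1]
        have h1 : ((Multiplicative.ofAdd ((taylor e (1 : Ω[X])).natTrailingDegree : ℤ),
            Units.mk0 (taylor e (1 : Ω[X])).trailingCoeff
              (by rw [Ne, trailingCoeff_eq_zero, taylor_eq_zero]; exact one_ne_zero)) :
              Multiplicative ℤ × Ωˣ) = 1 := by
          refine Prod.ext ?_ ?_
          · simp only [ht, natTrailingDegree_one, Nat.cast_zero, ofAdd_zero, Prod.fst_one]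
          · simp only [Prod.snd_one]
            ext
            rw [Units.val_mk0, Units.val_one, ht,
              trailingCoeff_eq_coeff_zero (by rw [coeff_one_zero]; exact one_ne_zero),
              coeff_one_zero]
        rw [h1, WithZero.coe_one]
      map_mul' := by
        intro p q
        by_cases hp : p = 0
        · simp only [hp, zero_mul, dif_pos, MulZeroClass.zero_mul]
        by_cases hq : q = 0
        · simp only [hq, mul_zero, dif_pos, MulZeroClass.mul_zero]
        have hpq : p * q ≠ 0 := mul_ne_zero hp hq
        rw [dif_neg hpq, dif_neg hp, dif_neg hq, ← WithZero.coe_mul, WithZero.coe_inj]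
        have htp : taylor e p ≠ 0 := by rwa [Ne, taylor_eq_zero]
        have htq : taylor e q ≠ 0 := by rwa [Ne, taylor_eq_zero]
        refine Prod.ext ?_ ?_
        · simp only [Prod.fst_mul, taylor_mul, natTrailingDegree_mul htp htq, Nat.cast_add,
            ofAdd_add]
        · simp only [Prod.snd_mul]
          ext
          simp only [Units.val_mk0, Units.val_mul, taylor_mul, trailingCoeff_mul] }
  have hφ0 : ∀ (e : Ω) (p : Ω[X]) (hp : p ≠ 0),
      φ e p = (((Multiplicative.ofAdd ((taylor e p).natTrailingDegree : ℤ),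
          Units.mk0 (taylor e p).trailingCoeff
            (by rwa [Ne, trailingCoeff_eq_zero, taylor_eq_zero])) : Multiplicative ℤ × Ωˣ) :
          WithZero (Multiplicative ℤ × Ωˣ)) := by
    intro e p hp
    exact dif_neg hp
  have hφ : ∀ e : Ω, nonZeroDivisors Ω[X] ≤ (nonZeroDivisors _).comap (φ e) := by
    intro e p hp
    have hp0 : p ≠ 0 := nonZeroDivisors.ne_zero hp
    rw [Submonoid.mem_comap]
    apply mem_nonZeroDivisors_of_ne_zero
    rw [hφ0 e p hp0]
    exact WithZero.coe_ne_zero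
  -- the restriction map at `e` on the units of `Ω(t)`
  let L : Ω → (RatFunc Ω →*₀ WithZero (Multiplicative ℤ × Ωˣ)) := fun e =>
    RatFunc.liftMonoidWithZeroHom (φ e) (hφ e)
  let res : Ω → ((RatFunc Ω)ˣ →* Multiplicative ℤ × Ωˣ) := fun e =>
    (WithZero.unitsWithZeroEquiv).toMonoidHom.comp (Units.map (L e : RatFunc Ω →* _))
  -- its value on a unit, in terms of numerator and denominator
  have hres : ∀ (e : Ω) (f : (RatFunc Ω)ˣ),
      ((res e f : Multiplicative ℤ × Ωˣ) : WithZero (Multiplicative ℤ × Ωˣ)) =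
        φ e (f : RatFunc Ω).num / φ e (f : RatFunc Ω).denom := by
    intro e f
    change ((WithZero.unitsWithZeroEquiv (Units.map (L e : RatFunc Ω →* _) f) :
        Multiplicative ℤ × Ωˣ) : WithZero (Multiplicative ℤ × Ωˣ)) = _
    rw [WithZero.coe_unitsWithZeroEquiv_eq_units_val, Units.coe_map]
    change L e (f : RatFunc Ω) = _
    conv_lhs => rw [← RatFunc.num_div_denom (f : RatFunc Ω)]
    exact RatFunc.liftMonoidWithZeroHom_apply_div (φ e) (hφ e) _ _
  refine ⟨{ Idx := ↥S.pts
            subgroup := fun i => MulAction.stabilizer Γ (i : Ω)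
            target := fun _ => Multiplicative ℤ × Ωˣ
            res := fun i => res (i : Ω) }, Equiv.refl _, fun i => rfl, ?_⟩
  intro i f
  change IsOfFinOrder (res (i : Ω) f) ↔ _
  simp only [Equiv.refl_apply]
  set e : Ω := (i : Ω) with he
  have hf0 : (f : RatFunc Ω) ≠ 0 := f.ne_zero
  have hnum : (f : RatFunc Ω).num ≠ 0 := RatFunc.num_ne_zero hf0
  have hden : (f : RatFunc Ω).denom ≠ 0 := RatFunc.denom_ne_zero _
  -- abbreviations for the orders and leading coefficients at `e`
  set m : ℕ := (taylor e (f : RatFunc Ω).num).natTrailingDegree with hm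
  set n : ℕ := (taylor e (f : RatFunc Ω).denom).natTrailingDegree with hn
  have htN : (taylor e (f : RatFunc Ω).num).trailingCoeff ≠ 0 := by
    rwa [Ne, trailingCoeff_eq_zero, taylor_eq_zero]
  have htD : (taylor e (f : RatFunc Ω).denom).trailingCoeff ≠ 0 := by
    rwa [Ne, trailingCoeff_eq_zero, taylor_eq_zero]
  have hval : res e f = ((Multiplicative.ofAdd (m : ℤ), Units.mk0 _ htN) : Multiplicative ℤ × Ωˣ) /
      (Multiplicative.ofAdd (n : ℤ), Units.mk0 _ htD) := by
    rw [← WithZero.coe_inj, WithZero.coe_div, hres e f, hφ0 e _ hnum, hφ0 e _ hden]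
  rw [hval, Prod.mk_div_mk, isOfFinOrder_prod_iff]
  rw [← ofAdd_sub, toAdd_ofAdd, sub_eq_zero, Nat.cast_inj, Units.val_div_eq_div_val, Units.val_mk0,
    Units.val_mk0]
  -- case analysis on the position of `e` relative to the divisor of `f`
  by_cases hN : (f : RatFunc Ω).num.eval e = 0
  · -- zero at `e`: positive order, and `RatFunc.eval` is `0 / b = 0`
    have hD : (f : RatFunc Ω).denom.eval e ≠ 0 := fun hD => not_eval_num_denom_eq_zero _ e ⟨hN, hD⟩
    have hn0 : n = 0 := (natTrailingDegree_taylor_eq_zero_iff hden e).mpr hD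
    have hm0 : m ≠ 0 := fun hm0 => (natTrailingDegree_taylor_eq_zero_iff hnum e).mp hm0 hN
    have hev : (f : RatFunc Ω).eval (RingHom.id Ω) e = 0 := by
      simp only [RatFunc.eval, Polynomial.eval₂_id, hN, zero_div]
    rw [hev, hn0]
    constructor
    · rintro ⟨h, -⟩; exact absurd h hm0
    · rintro ⟨N, hNpos, h⟩; rw [zero_pow hNpos.ne'] at h; exact absurd h zero_ne_one
  by_cases hD : (f : RatFunc Ω).denom.eval e = 0
  · -- pole at `e`: negative order, and `RatFunc.eval` is `a / 0 = 0`
    have hm0 : m = 0 := (natTrailingDegree_taylor_eq_zero_iff hnum e).mpr hN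
    have hn0 : n ≠ 0 := fun hn0 => (natTrailingDegree_taylor_eq_zero_iff hden e).mp hn0 hD
    have hev : (f : RatFunc Ω).eval (RingHom.id Ω) e = 0 := by
      simp only [RatFunc.eval, Polynomial.eval₂_id, hD, div_zero]
    rw [hev, hm0]
    constructor
    · rintro ⟨h, -⟩; exact absurd h.symm hn0
    · rintro ⟨N, hNpos, h⟩; rw [zero_pow hNpos.ne'] at h; exact absurd h zero_ne_one
  -- regular and nonvanishing at `e`: order `0`, leading coefficient = value
  have hm0 : m = 0 := (natTrailingDegree_taylor_eq_zero_iff hnum e).mpr hN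
  have hn0 : n = 0 := (natTrailingDegree_taylor_eq_zero_iff hden e).mpr hD
  have hev : (f : RatFunc Ω).eval (RingHom.id Ω) e =
      (f : RatFunc Ω).num.eval e / (f : RatFunc Ω).denom.eval e := by
    simp only [RatFunc.eval, Polynomial.eval₂_id]
  rw [hev, hm0, hn0, trailingCoeff_taylor_of_eval_ne_zero hN, trailingCoeff_taylor_of_eval_ne_zero hD]
  simp only [true_and]

/-! ### Consequences for abc-iut-L5-t12's `torsionLocus` / `DeterminesInfκStructure.some_iff_every` -/

variable {Γ : Type u} [Group Γ]

/-- **[MODEL] The torsion locus at the model.**  For restriction data whose maps detect exactly the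
root-of-unity values at the strictly critical points (as the MODEL data of
`exists_criticalRestrictionData_model` do), abc-iut-L5-t12's `CoricPair.torsionLocus κ R` — "the
subset of elements for which the restriction of the associated Kummer class to some subgroup … is a
torsion element" — is the set of elements whose Kummer image `κ x ∈ Ω(t)^×` takes a root-of-unity
value at SOME strictly critical point. ([IUTchI] Ex 5.1 (v) p.129) [claim: Mochizuki2012, status: disputed] -/
theorem torsionLocus_eq_of_res_iff [TopologicalSpace Γ] (S : CriticalLocus Ω) {P : CoricPair Γ}
    (κ : P.carrier → (RatFunc Ω)ˣ) (R : CriticalRestrictionData Γ (RatFunc Ω)ˣ)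
    (pt : R.Idx ≃ ↥S.pts)
    (hR : ∀ (i : R.Idx) (f : (RatFunc Ω)ˣ), IsOfFinOrder (R.res i f) ↔
      ∃ N : ℕ, 0 < N ∧ ((f : RatFunc Ω).eval (RingHom.id Ω) ((pt i : ↥S.pts) : Ω)) ^ N = 1) :
    CoricPair.torsionLocus κ R =
      {x | ∃ e ∈ S.pts, ∃ N : ℕ, 0 < N ∧ ((κ x : RatFunc Ω).eval (RingHom.id Ω) e) ^ N = 1} := by
  ext x
  simp only [CoricPair.torsionLocus, Set.mem_setOf_eq]
  constructor
  · rintro ⟨i, hi⟩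
    exact ⟨(pt i : Ω), (pt i).2, (hR i (κ x)).mp hi⟩
  · rintro ⟨e, he, hN⟩
    refine ⟨pt.symm ⟨e, he⟩, (hR _ _).mpr ?_⟩
    simpa only [Equiv.apply_symm_apply] using hN

/-- **[MODEL] "some [or, equivalently, every]" (p. 129) at the model.**  For restriction data as
above and an `∞κ×`-coric rational function `f` (abc-iut-L5-t2's `IsInftyKappaUnitCoric`, any unit
parameter `U`), the restricted class has finite order at SOME strictly critical point iff at EVERY one,
and either reading says exactly that `f` is `∞κ`-coric — by abc-iut-L5-t2's DISCHARGED Remark 3.1.7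
(ii) criterion `inftyKappaUnitCoricCriterion_holds`.  This is the clause
`DeterminesInfκStructure.some_iff_every` of abc-iut-L5-t12 together with the identification of the
torsion locus with `𝕄^⊛_∞κ`, at the model. ([IUTchI] Ex 5.1 (v) p.129) [claim: Mochizuki2012, status: disputed] -/
theorem isOfFinOrder_res_some_iff_every [CharZero Ω] (S : CriticalLocus Ω)
    (R : CriticalRestrictionData Γ (RatFunc Ω)ˣ) (pt : R.Idx ≃ ↥S.pts)
    (hR : ∀ (i : R.Idx) (f : (RatFunc Ω)ˣ), IsOfFinOrder (R.res i f) ↔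
      ∃ N : ℕ, 0 < N ∧ ((f : RatFunc Ω).eval (RingHom.id Ω) ((pt i : ↥S.pts) : Ω)) ^ N = 1)
    {U : Set Ω} (f : (RatFunc Ω)ˣ) (hf : S.IsInftyKappaUnitCoric U (f : RatFunc Ω)) :
    ((∃ i : R.Idx, IsOfFinOrder (R.res i f)) ↔ S.IsInftyKappaCoric (f : RatFunc Ω)) ∧
      ((∀ i : R.Idx, IsOfFinOrder (R.res i f)) ↔ S.IsInftyKappaCoric (f : RatFunc Ω)) := by
  obtain ⟨hsome, hevery⟩ := S.inftyKappaUnitCoricCriterion_holds U (f : RatFunc Ω) hf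
  constructor
  · rw [hsome]
    constructor
    · rintro ⟨i, hi⟩
      exact ⟨(pt i : Ω), (pt i).2, (hR i f).mp hi⟩
    · rintro ⟨e, he, hN⟩
      refine ⟨pt.symm ⟨e, he⟩, (hR _ _).mpr ?_⟩
      simpa only [Equiv.apply_symm_apply] using hN
  · rw [hevery]
    constructor
    · intro h e he
      have := (hR (pt.symm ⟨e, he⟩) f).mp (h _)
      simpa only [Equiv.apply_symm_apply] using this
    · intro h i
      exact (hR i f).mpr (h (pt i : Ω) (pt i).2)

/-- **[MODEL] Example 5.1 (v), first display, at the model of Remark 3.1.7 — the assembled witness.**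
There is restriction data (indexed by the strictly critical points, subgroups = their stabilisers
under `Γ ↷ Ω`, Kummer container `Ω(t)^×`) for which, for every `∞κ×`-coric rational function `f`,
"the restriction of the associated Kummer class to some [or, equivalently, every] subgroup … is a
torsion element" holds precisely when `f` is `∞κ`-coric: the torsion locus of `𝕄^⊛_∞κ×` is
`𝕄^⊛_∞κ`. ([IUTchI] Ex 5.1 (v) p.129) [claim: Mochizuki2012, status: disputed] -/
theorem exists_criticalRestrictionData_rmk317ii [CharZero Ω] (S : CriticalLocus Ω) (Γ : Type u)
    [Group Γ] [MulAction Γ Ω] (U : Set Ω) :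
    ∃ (R : CriticalRestrictionData Γ (RatFunc Ω)ˣ) (pt : R.Idx ≃ ↥S.pts),
      (∀ i, R.subgroup i = MulAction.stabilizer Γ ((pt i : ↥S.pts) : Ω)) ∧
      ∀ f : (RatFunc Ω)ˣ, S.IsInftyKappaUnitCoric U (f : RatFunc Ω) →
        ((∃ i : R.Idx, IsOfFinOrder (R.res i f)) ↔ S.IsInftyKappaCoric (f : RatFunc Ω)) ∧
        ((∀ i : R.Idx, IsOfFinOrder (R.res i f)) ↔ S.IsInftyKappaCoric (f : RatFunc Ω)) := by
  obtain ⟨R, pt, hsub, hR⟩ := S.exists_criticalRestrictionData_model Γ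
  exact ⟨R, pt, hsub, fun f hf => isOfFinOrder_res_some_iff_every S R pt hR f hf⟩

end CriticalLocus

end Literature.IUT.HodgeTheaters
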